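import Summits.QuantumFields.BalabanUV.Beta.GAN24.StencilSlotSThree
import Summits.QuantumFields.BalabanUV.Beta.GAN24.TopBorderKSlot
import Summits.QuantumFields.BalabanUV.Beta.GAN24.S3DiffLt
import Summits.QuantumFields.BalabanUV.Beta.GAN24.TaylorRowDWThree
import Summits.QuantumFields.BalabanUV.Beta.GAN24.S3DiffV
import Summits.QuantumFields.BalabanUV.Beta.GAN24.S3DiffL

/-!
# `BalabanUV.Beta.GAN24.StencilSlotSAllThree` — binder row G-an2-4 / (CONV-C), S-slot, road «S3»: THE WALL's `(hS, hSall)` AT `d = 3`, `Lc ≥ 2`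
# FROM THE THREE IN-FLIGHT DIFFERENCE ROWS `dW`, `dV`, `dL` ALONE (row owner b2b-balaban-gan24-p1, gen 4)

NOT IN PRINT; OUR PROOF ATTEMPT.  HONEST FRAMING (cell contract, verbatim): «discharging `BetaPertH` makes Bałaban's UV stability
UNCONDITIONAL — a real constructive-QFT result; it is NOT the continuum limit and NOT the Clay problem.»  HONEST DEPENDENCY (verbatim):
«continuum YM on T⁴ ⇐ BetaPertH ∧ nine spine estimates (0/9 proved); BetaPertH ⇐ (D1) ∧ (D4) ∧ CAP+tail; G-an2-4 gates asym, D1 and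
NE2/3/4.»

WHAT.  The countdown of the S-slot in the kernel: of the twelve analytic rows of `StencilSlotE3Tables.hS_hSall_of_rows`, NINE are tree theorems
at `d = 3` — the seven SHAPE rows (`TaylorRowW.rowW_three`, `S3RowV0.shapeV0`, `S3ShapeL0.rowL0_shape`, `S3ShapeVt.shapeVt_three`,
`TaylorRowLamTop.rowLamTop`, `TaylorRowV.rowV_three`, `TaylorRowLam.rowL_three`; composed in `StencilSlotSThree`) and the two top-increment
DIFFERENCE rows (`TopBorderKSlot.diffVt_three`, leaf-05; `S3DiffLt.diffLt_three`, leaf-04 — both through the K-slot's Cauchy half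
`KSlotAssembly.convCKWall_holds`).  `hS_hSall_three_of_diffRows`: the wall's S-binders `(hS, hSall)` for the Bałaban jets `JsBal0Of`, with their rate
data, follow from the THREE remaining DIFFERENCE rows `dW` (Wilson, consecutive members), `dV`, `dL` (depth-paired (V-H) ∕ Λ levels) ALONE — each
∃-packaged at its own ratios, texts verbatim from `StencilSlotRowsMerge.hS_hSall_of_rows_indep`.  When they land (holders leaf-15, leaf-03, leaf-11
of the G-an2-4 formalisation swarm), the unconditional `hS_hSall_three` is appended here as a three-name corollary.

HONEST: conditional on `dW`, `dV`, `dL` («E3SupRate» is NOT discharged); `hS` alone is unconditional (`StencilSlotSThree.hS_three`); (hW, hWall) are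
an2's (road P4); NOT «S-slot closed», NOT «G-an2-4 closed»; NOT BetaPertH, NOT continuum, NOT Clay.  [folklore] composition, every input BY NAME.
-/

noncomputable section

open Literature.MathematicalPhysics.QuantumFieldTheory
open Literature.MathematicalPhysics.QuantumFieldTheory.Balaban1983to89
open Literature.MathematicalPhysics.QuantumFieldTheory.Balaban1983to89.Beta
open ExpKernelCalculus (MKer VertexFamily₂)
open OneStepResolventKernel (Fib LocStencil)
open StepJetData (wilsonA)
open BalabanCompositeJets (pushSum borderInc lagrInc)
open BalabanStepJetsSucc (JsBal0Of)
open Summit.QuantumFields.BalabanUV.Beta.HessKerDressedUnits (unitS)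
open Summit.QuantumFields.BalabanUV.Beta.GAN24.CombesThomas (SupBound sfStep smStep)
open Summit.QuantumFields.BalabanUV.Beta.GAN24.E3UnitSplit (e3OfS)
open Summit.QuantumFields.BalabanUV.Beta.GAN24.StencilSlotOfE3 (one_le_of_two_le)
open Summit.QuantumFields.BalabanUV.Beta.GAN24.StencilSlotRowsMerge (hS_hSall_of_rows_indep)
open Summit.QuantumFields.BalabanUV.Beta.GAN24.StencilSlotSThree (inv_Lc_ratio)

namespace Summit.QuantumFields.BalabanUV.Beta.GAN24.StencilSlotSAllThree

variable {Lc : ℕ} [NeZero Lc]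

/-- **THE WALL's `(hS, hSall)` AT `d = 3`, `Lc ≥ 2`, FROM THE THREE IN-FLIGHT DIFFERENCE ROWS `dW`, `dV`, `dL` ALONE**: the nine landed rows by
name (seven SHAPE rows, `diffVt_three`, `diffLt_three`), repackaged (`0 ≤ c` dropped, `θ := Lc⁻¹` for V0∕Λ), and the three hypotheses, into
`StencilSlotRowsMerge.hS_hSall_of_rows_indep`. [folklore] composition. -/
theorem hS_hSall_three_of_diffRows (hLc : 2 ≤ Lc) (cE cVH cΛ : ℝ)
    (dW : ∃ eW θ : ℝ, 0 ≤ θ ∧ θ < 1 ∧ ∀ (n : ℕ) (κ' : Fin (3 + 1)) (u' : Fin (3 + 1) → ℤ), SupBound (fun x z a b =>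
      ((Lc : ℝ) ^ (n + 1 + 1 + 1)) ^ (2 * (3 + 1)) * e3OfS (Lc ^ (n + 1 + 1 + 1)) (fun κ u => (cE * ((Lc : ℝ) ^ (3 + 1)) ^ (n + 1 + 1)) • wilsonA 3 κ u) κ' u' x z a b -
      ((Lc : ℝ) ^ (n + 1 + 1)) ^ (2 * (3 + 1)) * e3OfS (Lc ^ (n + 1 + 1)) (fun κ u => (cE * ((Lc : ℝ) ^ (3 + 1)) ^ (n + 1)) • wilsonA 3 κ u) κ' u' x z a b) (eW * θ ^ (n + 1)))
    (dV : ∃ eV θ ρ : ℝ, 0 ≤ θ ∧ θ < 1 ∧ 0 ≤ ρ ∧ ρ < 1 ∧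
      ∀ (n m : ℕ), m < n → ∀ (κ' : Fin (3 + 1)) (u' : Fin (3 + 1) → ℤ), SupBound (fun x z a b =>
      ((Lc : ℝ) ^ (n + 1 + 1 + 1)) ^ (2 * (3 + 1)) * e3OfS (Lc ^ (n + 1 + 1 + 1)) (fun κ u => ((((Lc : ℝ) ^ (3 + 1)) ^ (n - m) * (cVH * ((Lc : ℝ) ^ (m + 1 + 1)) ^ (3 + 2))) •
        pushSum (Lc ^ (m + 1 + 1 + 1)) (Lc ^ (n - m)) (borderInc 3 Lc (Lc ^ (m + 1 + 1)) κ u))) κ' u' x z a b -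
      ((Lc : ℝ) ^ (n + 1 + 1)) ^ (2 * (3 + 1)) * e3OfS (Lc ^ (n + 1 + 1)) (fun κ u => ((((Lc : ℝ) ^ (3 + 1)) ^ (n - m) * (cVH * ((Lc : ℝ) ^ (m + 1)) ^ (3 + 2))) •
        pushSum (Lc ^ (m + 1 + 1)) (Lc ^ (n - m)) (borderInc 3 Lc (Lc ^ (m + 1)) κ u))) κ' u' x z a b) (eV * θ ^ (n + 1) * ρ ^ (n - m)))
    (dL : ∃ eL θ ρ : ℝ, 0 ≤ θ ∧ θ < 1 ∧ 0 ≤ ρ ∧ ρ < 1 ∧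
      ∀ (n m : ℕ), m < n → ∀ (κ' : Fin (3 + 1)) (u' : Fin (3 + 1) → ℤ), SupBound (fun x z a b =>
      ((Lc : ℝ) ^ (n + 1 + 1 + 1)) ^ (2 * (3 + 1)) * e3OfS (Lc ^ (n + 1 + 1 + 1)) (fun κ u => ((((Lc : ℝ) ^ (3 + 1)) ^ (n - m) * (cΛ * ((Lc : ℝ) ^ (m + 1 + 1)) ^ (2 * 3 + 4))) •
        lagrInc 3 Lc (Lc ^ (m + 1 + 1)) (Lc ^ (m + 1 + 1 + 1)) κ u)) κ' u' x z a b -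
      ((Lc : ℝ) ^ (n + 1 + 1)) ^ (2 * (3 + 1)) * e3OfS (Lc ^ (n + 1 + 1)) (fun κ u => ((((Lc : ℝ) ^ (3 + 1)) ^ (n - m) * (cΛ * ((Lc : ℝ) ^ (m + 1)) ^ (2 * 3 + 4))) •
        lagrInc 3 Lc (Lc ^ (m + 1)) (Lc ^ (m + 1 + 1)) κ u)) κ' u' x z a b) (eL * θ ^ (n + 1) * ρ ^ (n - m)))
    (W : ℕ → Fin (3 + 1) → (Fin (3 + 1) → ℤ) → Fin (3 + 1) → (Fin (3 + 1) → ℤ) → MKer (3 + 1) (Fib 3))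
    (Cw δw : ℕ → ℝ) (hδw : ∀ j, 0 < δw j) (hW' : ∀ j, VertexFamily₂ (W j) Lc (Cw j) (δw j)) :
    ∃ Cs cS θS δS : ℝ, 0 ≤ θS ∧ θS < 1 ∧ 0 < δS ∧
      (∀ j, LocStencil (unitS (sfStep Lc j) (smStep 3 Lc j) (JsBal0Of (one_le_of_two_le hLc) cE cVH cΛ W Cw δw hδw hW' j).S) Cs δS) ∧
      (∀ k j, LocStencil (unitS (sfStep Lc (k + j)) (smStep 3 Lc (k + j))
          (JsBal0Of (one_le_of_two_le hLc) cE cVH cΛ W Cw δw hδw hW' (k + j)).S -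
        unitS (sfStep Lc k) (smStep 3 Lc k) (JsBal0Of (one_le_of_two_le hLc) cE cVH cΛ W Cw δw hδw hW' k).S) (cS * θS ^ k) δS) := by
  have hLc1 : 1 ≤ Lc := one_le_of_two_le hLc
  obtain ⟨hι0, hι1⟩ := inv_Lc_ratio (Lc := Lc) hLc
  obtain ⟨c₀V, δ₂, -, hδ₂, hV0⟩ := S3RowV0.shapeV0 (Lc := Lc) hLc1 cVH
  obtain ⟨c₀L, θ₃, δ₃, -, hθ₃0, hθ₃1, hδ₃, hL0⟩ := S3ShapeL0.rowL0_shape (Lc := Lc) hLc cΛ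
  obtain ⟨cV, θ₆, δ₆, -, hθ₆0, hθ₆1, hδ₆, hV⟩ := TaylorRowV.rowV_three (Lc := Lc) hLc cVH
  obtain ⟨cL, δ₇, hδ₇, hL⟩ := TaylorRowLam.rowL_three (Lc := Lc) cΛ
  obtain ⟨cLt, θ₁₀, -, hθ₁₀0, hθ₁₀1, dLt⟩ := S3DiffLt.diffLt_three (Lc := Lc) hLc cΛ
  exact hS_hSall_of_rows_indep hLc cE cVH cΛ (TaylorRowW.rowW_three (Lc := Lc) cE) ⟨c₀V, (Lc : ℝ)⁻¹, δ₂, hδ₂, hι0, hι1, hV0⟩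
    ⟨c₀L, θ₃, δ₃, hδ₃, hθ₃0, hθ₃1, hL0⟩ (S3ShapeVt.shapeVt_three (Lc := Lc) hLc1 cVH) (TaylorRowLamTop.rowLamTop (Lc := Lc) hLc1 cΛ)
    ⟨cV, θ₆, δ₆, hδ₆, hθ₆0, hθ₆1, hV⟩ ⟨cL, (Lc : ℝ)⁻¹, δ₇, hδ₇, hι0, hι1, hL⟩ dW (TopBorderKSlot.diffVt_three (Lc := Lc) hLc cVH)
    ⟨cLt, θ₁₀, hθ₁₀0, hθ₁₀1, dLt⟩ dV dL W Cw δw hδw hW'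

/-! ## v1.1 APPENDIX (same gen): the three DIFFERENCE rows landed — `(hS, hSall)` UNCONDITIONAL at `d = 3`, `Lc ≥ 2` -/

/-- **THE WALL's S-BINDER PAIR `(hS, hSall)` IS UNCONDITIONAL AT `d = 3`, `Lc ≥ 2`** (with its rate data `0 ≤ θS < 1`, `0 < δS`): for the Bałaban
jets `JsBal0Of` — an2's W-slot data `(W, Cw, δw, hδw, hW')` only NAME the jets — the dressed-unit stencil tables are a `LocStencil` family with one
constant and one rate along the tower (`hS`) AND are Cauchy at a geometric rate (`hSall`): the two S-binders of asym1's wall theorem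
`HessKerConvCKPlug.d1Drift_JsBalOf_iff_of_convCKWall`, DISCHARGED.  Proof: `hS_hSall_three_of_diffRows` with the three DIFFERENCE rows now tree
theorems BY NAME — dW = `TaylorRowDWThree.rowDW_three` (leaf-15's `TaylorRowDW.rowDW_of_cauchy` over leaf-19's block-sample form of «(N1-Cauchy)»
`FineReadoutCauchyDecThree.blockSample_cauchy_three`, itself over leaf-17's team END `FineReadoutCauchyHolds.exists_wH_cellMean_cauchy`, PART A leaf-16,
parts leaf-13∕leaf-01∕leaf-20); dV = leaf-03's `S3DiffV.diffV_three`; dL = leaf-11's `S3DiffL.diffL_three` (generic leaf `SandwichDecimate*` leaf-04).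
With `StencilSlotSThree.hS_three` this closes the S-slot of binder row G-an2-4 at `d = 3`: of an2's four binder families `hS hSall hW hWall` the two
S-families are theorems (the K-families since gen 3); (hW, hWall) remain (an2, road P4).  HONEST: NOT «G-an2-4 closed», NOT (CONV-C); NOT BetaPertH,
NOT continuum, NOT Clay. [folklore] composition. -/
theorem hS_hSall_three (hLc : 2 ≤ Lc) (cE cVH cΛ : ℝ)
    (W : ℕ → Fin (3 + 1) → (Fin (3 + 1) → ℤ) → Fin (3 + 1) → (Fin (3 + 1) → ℤ) → MKer (3 + 1) (Fib 3))
    (Cw δw : ℕ → ℝ) (hδw : ∀ j, 0 < δw j) (hW' : ∀ j, VertexFamily₂ (W j) Lc (Cw j) (δw j)) :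
    ∃ Cs cS θS δS : ℝ, 0 ≤ θS ∧ θS < 1 ∧ 0 < δS ∧
      (∀ j, LocStencil (unitS (sfStep Lc j) (smStep 3 Lc j) (JsBal0Of (one_le_of_two_le hLc) cE cVH cΛ W Cw δw hδw hW' j).S) Cs δS) ∧
      (∀ k j, LocStencil (unitS (sfStep Lc (k + j)) (smStep 3 Lc (k + j))
          (JsBal0Of (one_le_of_two_le hLc) cE cVH cΛ W Cw δw hδw hW' (k + j)).S -
        unitS (sfStep Lc k) (smStep 3 Lc k) (JsBal0Of (one_le_of_two_le hLc) cE cVH cΛ W Cw δw hδw hW' k).S) (cS * θS ^ k) δS) := by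
  -- dW and dL in the binder packaging verbatim; dV: drop `0 ≤ cV`
  obtain ⟨cV, θ₁₁, ρ₁₁, -, hθ₁₁0, hθ₁₁1, hρ₁₁0, hρ₁₁1, dV⟩ := S3DiffV.diffV_three (Lc := Lc) hLc cVH
  exact hS_hSall_three_of_diffRows hLc cE cVH cΛ (TaylorRowDWThree.rowDW_three (Lc := Lc) hLc cE)
    ⟨cV, θ₁₁, ρ₁₁, hθ₁₁0, hθ₁₁1, hρ₁₁0, hρ₁₁1, dV⟩ (S3DiffL.diffL_three (Lc := Lc) hLc cΛ) W Cw δw hδw hW'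

end Summit.QuantumFields.BalabanUV.Beta.GAN24.StencilSlotSAllThree

end
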